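import Mathlib
import HarnessLib
import Summits.Ventures.LatticeQCDFlow.Exactness.SUNLeapfrogHMC
import Summits.Ventures.LatticeQCDFlow.Exactness.SUNExpChartMinorisation

/-!
# Single-step leapfrog HMC on `SU(N)` lattice gauge fields: one step dominates the configuration kicked by the chart kick

HONEST FRAMING: exact (Metropolis-corrected) sampling algorithms for lattice gauge theory;
figures of merit are autocorrelation/cost numbers at stated couplings and volumes; no
continuum-physics claim.

Venture `LatticeQCDFlow` (cell pub-lqcd), topic `Exactness`, FANOUT row 9 (eng-latcore, the
engine `latflow.core.hmc.HMC(f, β, 'leapfrog')` / `sun_2d.HMC2D` on `SU(N)`, `trajectory(τ, nstep = 1)`).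
NEW WORK of the cell over the tree (`SUNLeapfrogHMC.lean`: the kernel and its exactness;
`SUNExpChart.lean` / `SUNExpChartMinorisation.lean`: the chart maps; `LeapfrogHMCDoeblin.lean`:
acceptance windows, `flip_kdk_apply`, `smul_pi_le_pi`; `PiGroupKicks.lean`); nothing here is cited as a
fact.  Printed counterparts, named only: Duane–Kennedy–Pendleton–Roweth 1987; Meyn–Tweedie ch. 16.

THE DIFFERENCE WITH `SU(2)` (`SU2LeapfrogHMCErgodic.lean`, where the global chart `|A| < π` makes ONE
step Doeblin): for `N ≥ 3` the chart minorisation is local, so one HMC step from `U` only dominates a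
multiple of the law of `U` kicked, link by link and independently, by a law dominating Haar NEAR THE
IDENTITY (this file); a POWER of the kernel then dominates product Haar (`SUNLeapfrogHMCErgodic.lean`).

* §1 `refreshUpdate_involMH_minorised_at` — the refresh–propose–accept–forget minorant of
  `LeapfrogHMCDoeblin.lean` with a state-dependent comparison law.
* §2 `sunMomBox`, `smul_restrict_sunMomBox_le_sunMomentumLaw` (a refresh law `Z⁻¹e^{−T}μ^⊗` with `T`
  bounded on boxes dominates a multiple of `μ^⊗` on each box), `sunLeapfrog_energy_window`
  (`H(Ψ(U,p)) ≤ H(U,p) + 2s + τ(R + 2b)` on the box: `T ≥ 0` bounded by `τ` on boxes, force bounded by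
  `b`, action by `s`).
* §3 `chartKick ι hι μ` (the normalised image of `μ|_{B(0,1)}` under `suExp`; a probability law);
  `smul_restrict_ball_le_map_affine`, **`smul_mulWalk_chartKick_le`** — one kicked drift
  `a ↦ exp(ε ι (v + a)) · w` of `μ|_{B(0,R)}`, `R ≥ ε⁻¹ + |v|`, dominates `c_ε · chartKick · w` (scaling and
  translating the additive Haar `μ`); `pi_mulWalk` (independent link kicks = one kick on the product
  group); **`sunLeapfrogHMC_minorised_walk`** — `K(U, ·) ≥ δ₁ · (⊗ chartKick)·U` from EVERY `U`.

NOT CLAIMED: `nstep ≥ 2` / OMF / `tau_jitter`; any usable constant; floating point.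
-/

noncomputable section

namespace Summit.Ventures.LatticeQCDFlow.Exactness

open MeasureTheory ProbabilityTheory ProbabilityTheory.Kernel Set Metric Function NormedSpace Filter Topology
open Literature.MathematicalPhysics.QuantumFieldTheory (haarProbability)
open scoped ENNReal Matrix NNReal

/-! ## §1 The refresh minorant with a state-dependent comparison law -/

section Generic

variable {Ω P : Type*} [MeasurableSpace Ω] [MeasurableSpace P]

/-- **Doeblin-type minorant for refresh–propose–accept–forget, at one state.**  As
`refreshUpdate_involMH_minorised`, but the comparison law `π₀` and the hypotheses are those of the
given state `u` only. -/
theorem refreshUpdate_involMH_minorised_at {Ψ : Ω × P → Ω × P} (hΨ : Measurable Ψ) {H : Ω × P → ℝ}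
    (hH : Measurable H) (μP : Measure P) [SFinite μP] {ρ : Measure P} (hρ : ρ ≤ μP) {a : ℝ≥0∞} (u : Ω)
    (hacc : ∀ᵐ p ∂ρ, a ≤ involAcceptE H Ψ (u, p)) {π₀ : Measure Ω} {δ : ℝ≥0∞}
    (hpush : δ • π₀ ≤ ρ.map (fun p => (Ψ (u, p)).1)) :
    (a * δ) • π₀ ≤ refreshUpdate (involMH Ψ hΨ H) μP u := by
  refine Measure.le_iff.2 fun A hA => ?_
  have hA' : MeasurableSet (Prod.fst ⁻¹' A : Set (Ω × P)) := measurable_fst hA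
  have hΨu : Measurable fun p : P => Ψ (u, p) := hΨ.comp measurable_prodMk_left
  have hΨ1 : Measurable fun p : P => (Ψ (u, p)).1 := measurable_fst.comp hΨu
  have hind : Measurable fun p : P => (Prod.fst ⁻¹' A : Set (Ω × P)).indicator 1 (Ψ (u, p)) :=
    ((show Measurable (1 : Ω × P → ℝ≥0∞) from measurable_one).indicator hA').comp hΨu
  have hδ := Measure.le_iff.1 hpush A hA
  rw [Measure.smul_apply, smul_eq_mul, Measure.map_apply hΨ1 hA] at hδ
  rw [Measure.smul_apply, smul_eq_mul, refreshUpdate_apply' _ _ _ hA]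
  have hpre : ρ ((fun p : P => (Ψ (u, p)).1) ⁻¹' A) =
      ∫⁻ p, (Prod.fst ⁻¹' A : Set (Ω × P)).indicator 1 (Ψ (u, p)) ∂ρ := by
    rw [← lintegral_indicator_one (hΨ1 hA)]
    rfl
  calc a * δ * π₀ A ≤ a * ρ ((fun p : P => (Ψ (u, p)).1) ⁻¹' A) := by
        rw [mul_assoc]; gcongr
    _ = ∫⁻ p, a * (Prod.fst ⁻¹' A : Set (Ω × P)).indicator 1 (Ψ (u, p)) ∂ρ := by
        rw [hpre, lintegral_const_mul _ hind]
    _ ≤ ∫⁻ p, involAcceptE H Ψ (u, p) * (Prod.fst ⁻¹' A : Set (Ω × P)).indicator 1 (Ψ (u, p)) ∂ρ :=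
        lintegral_mono_ae (hacc.mono fun p hp => by gcongr)
    _ ≤ ∫⁻ p, involAcceptE H Ψ (u, p) * (Prod.fst ⁻¹' A : Set (Ω × P)).indicator 1 (Ψ (u, p)) ∂μP :=
        lintegral_mono' hρ le_rfl
    _ ≤ ∫⁻ p, involMH Ψ hΨ H (u, p) (Prod.fst ⁻¹' A) ∂μP :=
        lintegral_mono fun p => involAcceptE_mul_indicator_le_involMH hΨ hH (u, p) hA'

end Generic

/-! ## §2 The momentum box: refresh domination and the energy window -/

section SUN

variable {n : Type*} [Fintype n] [DecidableEq n]
variable {E : Type*} [NormedAddCommGroup E] [NormedSpace ℝ E] [MeasurableSpace E] [BorelSpace E]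
  [FiniteDimensional ℝ E]
variable (ι : E →ₗ[ℝ] Matrix n n ℂ) (hι : ∀ a, (ι a)ᴴ = -ι a ∧ (ι a).trace = 0)
variable {L : Type*} [Fintype L] (μ : Measure E) [μ.IsAddHaarMeasure]

/-- The momentum box `|p_l| < R` for every link. -/
def sunMomBox (R : ℝ) : Set (L → E) := Set.pi univ fun _ => ball 0 R

omit [Fintype L] [BorelSpace E] [FiniteDimensional ℝ E] [NormedSpace ℝ E] in
/-- The momentum box is measurable. -/
theorem measurableSet_sunMomBox [Countable L] [OpensMeasurableSpace E] (R : ℝ) :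
    MeasurableSet (sunMomBox (L := L) (E := E) R) :=
  MeasurableSet.univ_pi fun _ => measurableSet_ball

omit [Fintype L] [MeasurableSpace E] [BorelSpace E] [FiniteDimensional ℝ E] [NormedSpace ℝ E] in
/-- Inside the box every component is shorter than `R`. -/
theorem norm_le_of_mem_sunMomBox {R : ℝ} {p : L → E} (hp : p ∈ sunMomBox R) (l : L) : ‖p l‖ ≤ R :=
  (mem_ball_zero_iff.1 (hp l (mem_univ l))).le

variable (T : (L → E) → ℝ) (τ : ℝ → ℝ)

omit [NormedSpace ℝ E] [FiniteDimensional ℝ E] [μ.IsAddHaarMeasure] in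
/-- **A refresh law whose kinetic term is bounded on boxes dominates a multiple of `μ^{⊗links}` on
each box**: `Z⁻¹ e^{−τ(R)} · μ^⊗|_{box R} ≤ Z⁻¹ e^{−T} μ^⊗`. -/
theorem smul_restrict_sunMomBox_le_sunMomentumLaw [Countable L]
    (hTle : ∀ (R : ℝ) (p : L → E), (∀ l, ‖p l‖ ≤ R) → T p ≤ τ R) (R : ℝ) :
    ((sunMomentumWeight (L := L) μ T univ)⁻¹ * ENNReal.ofReal (Real.exp (-τ R))) •
        (Measure.pi fun _ : L => μ).restrict (sunMomBox (L := L) R) ≤ sunMomentumLaw μ T := by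
  rw [sunMomentumLaw, mul_smul]
  have hinner : ENNReal.ofReal (Real.exp (-τ R)) • (Measure.pi fun _ : L => μ).restrict (sunMomBox (L := L) R) ≤
      sunMomentumWeight μ T := by
    rw [← withDensity_const, sunMomentumWeight]
    calc ((Measure.pi fun _ : L => μ).restrict (sunMomBox (L := L) R)).withDensity
          (fun _ => ENNReal.ofReal (Real.exp (-τ R)))
        ≤ ((Measure.pi fun _ : L => μ).restrict (sunMomBox (L := L) R)).withDensity
            fun p => ENNReal.ofReal (Real.exp (-T p)) := by
          refine withDensity_mono ((ae_restrict_iff' (measurableSet_sunMomBox R)).2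
            (Filter.Eventually.of_forall fun p hp => ?_))
          exact ENNReal.ofReal_le_ofReal (Real.exp_le_exp.2 (neg_le_neg (hTle R p (norm_le_of_mem_sunMomBox hp))))
      _ = ((Measure.pi fun _ : L => μ).withDensity fun p => ENNReal.ofReal (Real.exp (-T p))).restrict (sunMomBox R) :=
          (restrict_withDensity (measurableSet_sunMomBox R) _).symm
      _ ≤ (Measure.pi fun _ : L => μ).withDensity fun p => ENNReal.ofReal (Real.exp (-T p)) := Measure.restrict_le_self
  refine Measure.le_iff'.2 fun A => ?_
  have hA := Measure.le_iff'.1 hinner A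
  simp only [Measure.smul_apply, smul_eq_mul] at hA ⊢
  gcongr

variable {T τ} (ε : ℝ) {g : (L → Matrix.specialUnitaryGroup n ℂ) → L → E}

omit [MeasurableSpace E] [BorelSpace E] [FiniteDimensional ℝ E] [Fintype L] in
/-- **The energy window of one leapfrog step**: for momenta in the box `|p_l| ≤ R`, a kinetic term
`T ≥ 0` bounded by `τ` on boxes, a force bounded by `b` and an action bounded by `s`,
`H(Ψ(U, p)) ≤ H(U, p) + 2s + τ(R + 2b)`. -/
theorem sunLeapfrog_energy_window (hT0 : ∀ p, 0 ≤ T p)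
    (hTle : ∀ (R : ℝ) (p : L → E), (∀ l, ‖p l‖ ≤ R) → T p ≤ τ R) {b : ℝ} (hb : ∀ u l, ‖g u l‖ ≤ b)
    {S : (L → Matrix.specialUnitaryGroup n ℂ) → ℝ} {s : ℝ} (hs : ∀ u, |S u| ≤ s) {R : ℝ}
    (u : L → Matrix.specialUnitaryGroup n ℂ) {p : L → E} (hp : ∀ l, ‖p l‖ ≤ R) :
    (fun z : (L → Matrix.specialUnitaryGroup n ℂ) × (L → E) => S z.1 + T z.2) (sunLeapfrogProposal ι hι ε g (u, p)) ≤
      (fun z : (L → Matrix.specialUnitaryGroup n ℂ) × (L → E) => S z.1 + T z.2) (u, p) + (2 * s + τ (R + 2 * b)) := by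
  rw [sunLeapfrogProposal, flip_kdk_apply]
  simp only
  have h1 : S (mulDrift (sunExpDrift ι hι ε) (p + g u) u) ≤ s := (abs_le.1 (hs _)).2
  have h2 : -s ≤ S u := (abs_le.1 (hs u)).1
  have h3 : 0 ≤ T p := hT0 p
  have h4 : T (-(p + g u + g (mulDrift (sunExpDrift ι hι ε) (p + g u) u))) ≤ τ (R + 2 * b) := by
    refine hTle _ _ fun l => ?_
    simp only [Pi.neg_apply, Pi.add_apply, norm_neg]
    calc ‖p l + g u l + g (mulDrift (sunExpDrift ι hι ε) (p + g u) u) l‖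
        ≤ ‖p l‖ + ‖g u l‖ + ‖g (mulDrift (sunExpDrift ι hι ε) (p + g u) u) l‖ := norm_add₃_le
      _ ≤ R + b + b := add_le_add (add_le_add (hp l) (hb u l)) (hb _ l)
      _ = R + 2 * b := by ring
  linarith

/-! ## §3 The chart kick: one kicked drift of `μ|_{ball}` dominates it, link by link and on the product -/

/-- **The chart kick**: the normalised image of `μ|_{B(0,1)}` under the exponential — a probability
law on `SU(N)` dominating a multiple of Haar measure near `1` (by `SUNExpChartMinorisation.lean`). -/
def chartKick : Measure (Matrix.specialUnitaryGroup n ℂ) :=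
  (μ (ball (0 : E) 1))⁻¹ • (μ.restrict (ball (0 : E) 1)).map (suExp ι hι)

/-- The chart kick is a probability law. -/
instance isProbabilityMeasure_chartKick : IsProbabilityMeasure (chartKick ι hι μ) := by
  refine ⟨?_⟩
  rw [chartKick, Measure.smul_apply, smul_eq_mul, Measure.map_apply (continuous_suExp ι hι).measurable MeasurableSet.univ,
    preimage_univ, Measure.restrict_apply MeasurableSet.univ, univ_inter,
    ENNReal.inv_mul_cancel (measure_ball_pos μ _ one_pos).ne' measure_ball_lt_top.ne]

/-- **Scaling and translating the additive Haar measure**: for `ε > 0`, `|v| ≤ b` and `ε⁻¹ + b ≤ R`,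
`|ε^{−d}| • μ|_{B(0,1)} ≤ (μ|_{B(0,R)}) ∘ (a ↦ ε(v + a))⁻¹` (the preimage of the unit ball lies inside
`B(0,R)`; translation invariance and the scaling law of `μ`). -/
theorem smul_restrict_ball_le_map_affine {ε : ℝ} (hε : 0 < ε) {v : E} {b R : ℝ} (hv : ‖v‖ ≤ b) (hR : ε⁻¹ + b ≤ R) :
    ENNReal.ofReal |(ε ^ Module.finrank ℝ E)⁻¹| • μ.restrict (ball (0 : E) 1) ≤
      (μ.restrict (ball (0 : E) R)).map (fun a => ε • (v + a)) := by
  have hmeas : Measurable fun a : E => ε • (v + a) := (measurable_const_add v).const_smul ε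
  refine Measure.le_iff.2 fun B hB => ?_
  rw [Measure.smul_apply, smul_eq_mul, Measure.restrict_apply hB, Measure.map_apply hmeas hB,
    Measure.restrict_apply (hB.preimage hmeas)]
  have hsub : (fun a : E => v + a) ⁻¹' ((fun a : E => ε • a) ⁻¹' (B ∩ ball 0 1)) ⊆
      (fun a : E => ε • (v + a)) ⁻¹' B ∩ ball 0 R := by
    intro a ha
    simp only [mem_preimage, mem_inter_iff, mem_ball_zero_iff] at ha
    refine ⟨ha.1, ?_⟩
    rw [mem_ball_zero_iff]
    have h1 : ‖v + a‖ < ε⁻¹ := by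
      rw [norm_smul, Real.norm_of_nonneg hε.le] at ha
      rw [← one_div, lt_div_iff₀ hε, mul_comm]
      exact ha.2
    calc ‖a‖ = ‖(v + a) - v‖ := by rw [add_sub_cancel_left]
      _ ≤ ‖v + a‖ + ‖v‖ := norm_sub_le _ _
      _ < ε⁻¹ + b := add_lt_add_of_lt_of_le h1 hv
      _ ≤ R := hR
  calc ENNReal.ofReal |(ε ^ Module.finrank ℝ E)⁻¹| * μ (B ∩ ball 0 1)
      = μ ((fun a : E => ε • a) ⁻¹' (B ∩ ball 0 1)) := (Measure.addHaar_preimage_smul μ hε.ne' _).symm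
    _ = μ ((fun a : E => v + a) ⁻¹' ((fun a : E => ε • a) ⁻¹' (B ∩ ball 0 1))) := (measure_preimage_add μ v _).symm
    _ ≤ μ ((fun a : E => ε • (v + a)) ⁻¹' B ∩ ball 0 R) := measure_mono hsub

/-- The kicked drift of one link `a ↦ exp(ε ι (v + a)) · w` is continuous, hence measurable. -/
theorem measurable_sunKickDrift (ε : ℝ) (v : E) (w : Matrix.specialUnitaryGroup n ℂ) :
    Measurable fun a : E => suExp ι hι (ε • (v + a)) * w :=
  (((continuous_suExp ι hι).comp ((continuous_const.add continuous_id).const_smul ε)).mul continuous_const).measurable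

/-- **ONE KICKED DRIFT OF `μ|_{B(0,R)}` DOMINATES A MULTIPLE OF THE CHART KICK**, uniformly in the kick
`|v| ≤ b` and the frozen link `w`: for `ε > 0` and `ε⁻¹ + b ≤ R`,
`(|ε^{−d}| μ(B(0,1))) • chartKick · w ≤ (μ|_{B(0,R)}) ∘ (a ↦ exp(ε ι(v + a)) · w)⁻¹`. -/
theorem smul_mulWalk_chartKick_le {ε : ℝ} (hε : 0 < ε) {v : E} {b R : ℝ} (hv : ‖v‖ ≤ b) (hR : ε⁻¹ + b ≤ R)
    (w : Matrix.specialUnitaryGroup n ℂ) :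
    (ENNReal.ofReal |(ε ^ Module.finrank ℝ E)⁻¹| * μ (ball (0 : E) 1)) • mulWalk (chartKick ι hι μ) w ≤
      (μ.restrict (ball (0 : E) R)).map (fun a => suExp ι hι (ε • (v + a)) * w) := by
  have hmeasA : Measurable fun a : E => ε • (v + a) := (measurable_const_add v).const_smul ε
  have hmeasG : Measurable fun b : E => suExp ι hι b * w := ((continuous_suExp ι hι).mul continuous_const).measurable
  have hb0 : μ (ball (0 : E) 1) ≠ 0 := (measure_ball_pos μ _ one_pos).ne'
  have hbt : μ (ball (0 : E) 1) ≠ ⊤ := measure_ball_lt_top.ne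
  have hcomp : (fun a : E => suExp ι hι (ε • (v + a)) * w) = (fun b : E => suExp ι hι b * w) ∘ fun a : E => ε • (v + a) := rfl
  rw [hcomp, ← Measure.map_map hmeasG hmeasA, mulWalk_apply, chartKick, Measure.map_smul,
    Measure.map_map (measurable_mul_const w) (continuous_suExp ι hι).measurable]
  have hG : ((fun g : Matrix.specialUnitaryGroup n ℂ => g * w) ∘ suExp ι hι) = fun b : E => suExp ι hι b * w := rfl
  rw [hG, smul_smul, mul_assoc, ENNReal.mul_inv_cancel hb0 hbt, mul_one, ← Measure.map_smul]
  exact Measure.map_mono (smul_restrict_ball_le_map_affine μ hε hv hR) hmeasG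

/-- **Independent link kicks are one kick on the product group**: `⊗_l (ρ · u_l) = (⊗ ρ) · u`. -/
theorem pi_mulWalk {G : Type*} [Group G] [MeasurableSpace G] [MeasurableMul₂ G] (ρ : Measure G)
    [IsProbabilityMeasure ρ] (u : L → G) :
    Measure.pi (fun l : L => mulWalk ρ (u l)) = mulWalk (Measure.pi fun _ : L => ρ) u := by
  rw [mulWalk_apply]
  simp_rw [mulWalk_apply]
  rw [← Measure.pi_map_pi (fun l => (measurable_mul_const (u l)).aemeasurable)]
  rfl

/-- **`K(U, ·) ≥ δ₁ · (⊗ chartKick)·U` FROM EVERY CONFIGURATION `U`.**  For `ε > 0`, a measurable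
kinetic term `T ≥ 0` bounded by `τ` on boxes, a measurable force increment bounded by `b ≥ 0` and a
measurable action bounded by `s`, one HMC step from `U` dominates a positive multiple of the law of `U`
kicked link by link, independently, by the chart kick. -/
theorem sunLeapfrogHMC_minorised_walk {ε : ℝ} (hε : 0 < ε) (hT : Measurable T) (hT0 : ∀ p, 0 ≤ T p)
    (hTle : ∀ (R : ℝ) (p : L → E), (∀ l, ‖p l‖ ≤ R) → T p ≤ τ R) (hZ : sunMomentumWeight (L := L) μ T univ ≠ ⊤)
    (hg : Measurable g) {b : ℝ} (hb0 : 0 ≤ b) (hb : ∀ u l, ‖g u l‖ ≤ b)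
    {S : (L → Matrix.specialUnitaryGroup n ℂ) → ℝ} (hS : Measurable S) {s : ℝ} (hs : ∀ u, |S u| ≤ s) :
    ∃ δ : ℝ≥0∞, 0 < δ ∧ ∀ u, δ • mulWalk (Measure.pi fun _ : L => chartKick ι hι μ) u ≤
      sunLeapfrogHMC ι hι μ T ε hg S u := by
  classical
  set R : ℝ := ε⁻¹ + b with hR
  set cbox : ℝ≥0∞ := (sunMomentumWeight (L := L) μ T univ)⁻¹ * ENNReal.ofReal (Real.exp (-τ R)) with hcbox
  set B : ℝ := 2 * s + τ (R + 2 * b) with hB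
  set cε : ℝ≥0∞ := ENNReal.ofReal |(ε ^ Module.finrank ℝ E)⁻¹| * μ (ball (0 : E) 1) with hcε
  have hH : Measurable fun z : (L → Matrix.specialUnitaryGroup n ℂ) × (L → E) => S z.1 + T z.2 :=
    (hS.comp measurable_fst).add (hT.comp measurable_snd)
  have hs0 : 0 ≤ s := (abs_nonneg _).trans (hs fun _ => 1)
  have hτ0 : 0 ≤ τ (R + 2 * b) :=
    (hT0 0).trans (hTle _ 0 fun l => by simp only [Pi.zero_apply, norm_zero]; positivity)
  have hB0 : 0 ≤ B := by positivity
  have hcbox0 : cbox ≠ 0 := mul_ne_zero (ENNReal.inv_ne_zero.2 hZ) (ENNReal.ofReal_pos.2 (Real.exp_pos _)).ne'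
  have hcε0 : cε ≠ 0 := mul_ne_zero (by
      rw [Ne, ENNReal.ofReal_eq_zero, not_le, abs_pos]
      exact inv_ne_zero (pow_ne_zero _ hε.ne')) (measure_ball_pos μ _ one_pos).ne'
  refine ⟨ENNReal.ofReal (Real.exp (-B)) * (cbox * cε ^ Fintype.card L), ?_, fun u => ?_⟩
  · exact ENNReal.mul_pos (ENNReal.ofReal_pos.2 (Real.exp_pos _)).ne' (mul_ne_zero hcbox0 (pow_ne_zero _ hcε0))
  -- the refresh minorant at `u`, comparison law `(⊗ chartKick)·u`
  refine refreshUpdate_involMH_minorised_at (measurable_sunLeapfrogProposal ι hι ε hg) hH (sunMomentumLaw μ T)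
    (ρ := cbox • (Measure.pi fun _ : L => μ).restrict (sunMomBox (L := L) R))
    (smul_restrict_sunMomBox_le_sunMomentumLaw μ T τ hTle R) u
    (Measure.ae_smul_measure ((ae_restrict_iff' (measurableSet_sunMomBox R)).2
      (Filter.Eventually.of_forall fun p hp => le_involAcceptE_of_le hB0
        (sunLeapfrog_energy_window ι hι ε hT0 hTle hb hs u (norm_le_of_mem_sunMomBox hp)))) _) ?_
  -- the proposed configuration: `⊗_l` (one kicked drift of `μ|_{ball R}`) `≥ cε^{|L|} • (⊗ chartKick)·u`
  have hfun : (fun p : L → E => (sunLeapfrogProposal ι hι ε g (u, p)).1) =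
      fun p l => (fun (l : L) (a : E) => suExp ι hι (ε • (g u l + a)) * u l) l (p l) := by
    funext p
    rw [sunLeapfrogProposal, fst_flip_kdk]
    funext l
    simp only [mulDrift, Equiv.coe_mulLeft, Pi.mul_apply, sunExpDrift_apply, Pi.add_apply, add_comm (p l) (g u l)]
  haveI hfin : IsFiniteMeasure (μ.restrict (ball (0 : E) R)) :=
    ⟨by rw [Measure.restrict_apply_univ]; exact measure_ball_lt_top⟩
  rw [Measure.map_smul, hfun, sunMomBox, Measure.restrict_pi_pi,
    Measure.pi_map_pi (fun l => (measurable_sunKickDrift ι hι ε (g u l) (u l)).aemeasurable), mul_smul]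
  refine Measure.le_iff'.2 fun A => ?_
  simp only [Measure.smul_apply, smul_eq_mul]
  refine mul_le_mul' le_rfl ?_
  have hpi : cε ^ Fintype.card L • Measure.pi (fun l : L => mulWalk (chartKick ι hι μ) (u l)) ≤
      Measure.pi fun l : L => (μ.restrict (ball (0 : E) R)).map fun a => suExp ι hι (ε • (g u l + a)) * u l := by
    have h := smul_pi_le_pi (c := fun _ : L => cε) fun l =>
      smul_mulWalk_chartKick_le ι hι μ hε (hb u l) (le_refl R) (u l)
    rwa [Finset.prod_const, Finset.card_univ] at h
  rw [pi_mulWalk] at hpi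
  exact Measure.le_iff'.1 hpi A

end SUN

end Summit.Ventures.LatticeQCDFlow.Exactness
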